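import Summits.Schanuel.Schanuel.Theorems.RootDecomp1BTranscendencePackageFloor01

/-!
# `RootDecomp1BTranscendencePackageFloor` — part 02 of 05 (`RootDecomp1BTranscendencePackageFloor02`): §1 real and complex algebraic numbers `A`, `ℚ̄`; §2 the SHEAR data `structure Shear` and the twist `θ = id + Φ·d` (`Shear.θ`, `Shear.θinv`, bijectivity, additivity, `conj`-equivariance, `ℚ̄`-linearity `Shear.θQb`)

See part 01 (`Summits.Schanuel.Schanuel.Theorems.RootDecomp1BTranscendencePackageFloor01`) for the overview of the port (decomp-schanuel lens-4, gens 16–17; `--supports stmt-Schanuel-24622`; sorry-free, standard axioms; nothing here proves Schanuel — rung 0).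
-/

noncomputable section

open Complex

set_option linter.dupNamespace false

namespace Summit.Schanuel.Schanuel.Theorems.RootDecomp1BTranscendencePackageFloor

/-! ## §1 Real and complex algebraic numbers -/

/-- The field of real algebraic numbers `A = ℚ̄ ∩ ℝ`. [folklore] -/
abbrev A : IntermediateField ℚ ℝ := algebraicClosure ℚ ℝ

/-- The field of complex algebraic numbers `ℚ̄ ⊂ ℂ`. [folklore] -/
abbrev Qb : IntermediateField ℚ ℂ := algebraicClosure ℚ ℂ

/-- Membership in `ℚ̄ ⊂ ℂ` is algebraicity over `ℚ`. [folklore] -/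
theorem mem_Qb_iff {z : ℂ} : z ∈ Qb ↔ IsAlgebraic ℚ z := mem_algebraicClosure_iff

/-- Membership in `A = ℚ̄ ∩ ℝ` is algebraicity over `ℚ`. [folklore] -/
theorem mem_A_iff {x : ℝ} : x ∈ A ↔ IsAlgebraic ℚ x := mem_algebraicClosure_iff

/-- `x ∈ A ↔ (x : ℂ) ∈ ℚ̄`. [folklore] -/
theorem mem_A_iff_coe_mem_Qb {x : ℝ} : x ∈ A ↔ (x : ℂ) ∈ Qb := by
  rw [mem_A_iff, mem_Qb_iff]
  have h := isAlgebraic_algHom_iff (R := ℚ) (a := x) ((algebraMap ℝ ℂ).toRatAlgHom)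
    (by intro a b hab; exact Complex.ofReal_injective hab)
  exact h.symm

/-- `i ∈ ℚ̄` (`i² + 1 = 0`). [folklore] -/
theorem I_mem_Qb : I ∈ Qb := by
  rw [mem_Qb_iff]
  refine ⟨Polynomial.X ^ 2 + 1, ?_, ?_⟩
  · intro h
    have := congrArg (fun p : Polynomial ℚ => p.coeff 2) h
    simp [Polynomial.coeff_one] at this
  · simp

/-- `ℚ̄` is stable under complex conjugation. [folklore] -/
theorem conj_mem_Qb {q : ℂ} (hq : q ∈ Qb) : (starRingEnd ℂ) q ∈ Qb := by
  rw [mem_Qb_iff] at hq ⊢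
  exact hq.algHom ((starRingEnd ℂ).toRatAlgHom)

/-- `ℚ ⊆ ℚ̄`. [folklore] -/
theorem ratCast_mem_Qb (q : ℚ) : (q : ℂ) ∈ Qb := by
  simp

/-- The real part of an algebraic number is (real) algebraic: `Re q = (q + q̄)/2`. [folklore] -/
theorem re_mem_A {q : ℂ} (hq : q ∈ Qb) : q.re ∈ A := by
  rw [mem_A_iff_coe_mem_Qb]
  have h2 : (2 : ℂ) ∈ Qb := by simp
  have h : ((q.re : ℝ) : ℂ) = (q + (starRingEnd ℂ) q) / 2 := by
    rw [Complex.add_conj]; push_cast; ring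
  rw [h]
  exact div_mem (add_mem hq (conj_mem_Qb hq)) h2

/-- The imaginary part of an algebraic number is (real) algebraic: `Im q = Re(−i q)`. [folklore] -/
theorem im_mem_A {q : ℂ} (hq : q ∈ Qb) : q.im ∈ A := by
  have h := re_mem_A (mul_mem (neg_mem I_mem_Qb) hq)
  simpa using h

/-! ## §2 Shear data: an `A`-linear functional and the twist `θ = id + Φ·d` -/

/-- SHEAR DATA: an `A`-linear functional `φ : ℝ → A` (`A = ℚ̄ ∩ ℝ`) together with two marked
reals `u`, `ℓ` such that `φ 1 = 0` (so `φ` vanishes on `A`), `φ u = 1` and `φ ℓ ≠ 0`. From it,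
`θ = id + (φ∘Re + i φ∘Im)·(ℓ − u)` is a `ℚ̄`-linear bijection of `ℂ` with `θ u = ℓ`. [folklore] -/
structure Shear where
  /-- the `A`-linear functional `ℝ → A` -/
  φ : ℝ →ₗ[A] A
  /-- the point to be moved -/
  u : ℝ
  /-- its image under the shear -/
  ℓ : ℝ
  /-- `φ` kills `1` (hence all of `A`) -/
  φ_one : φ 1 = 0
  /-- normalisation `φ u = 1` -/
  φ_u : φ u = 1
  /-- non-degeneracy `φ ℓ ≠ 0` (makes `θ` invertible) -/
  φ_ℓ : φ ℓ ≠ 0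

namespace Shear

variable (S : Shear)

/-- The real-valued functional. [folklore] -/
def φR (x : ℝ) : ℝ := (S.φ x : ℝ)

/-- The displacement `d = ℓ - u`. [folklore] -/
def d : ℝ := S.ℓ - S.u

/-- The constant `c = φ ℓ ∈ A`, nonzero. [folklore] -/
def c : ℝ := (S.φ S.ℓ : ℝ)

/-- `φ` is additive. [folklore] -/
theorem φR_add (x y : ℝ) : S.φR (x + y) = S.φR x + S.φR y := by
  simp [φR, map_add]

/-- `φ (−x) = −φ x`. [folklore] -/
theorem φR_neg (x : ℝ) : S.φR (-x) = -S.φR x := by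
  simp [φR, map_neg]

/-- `φ (x − y) = φ x − φ y`. [folklore] -/
theorem φR_sub (x y : ℝ) : S.φR (x - y) = S.φR x - S.φR y := by
  simp [φR, map_sub]

/-- `φ 0 = 0`. [folklore] -/
theorem φR_zero : S.φR 0 = 0 := by simp [φR]

/-- `A`-linearity: `φ (a x) = a φ x` for `a ∈ A`. [folklore] -/
theorem φR_mul_of_mem {a : ℝ} (ha : a ∈ A) (x : ℝ) : S.φR (a * x) = a * S.φR x := by
  have h : S.φ ((⟨a, ha⟩ : A) • x) = (⟨a, ha⟩ : A) • S.φ x := map_smul S.φ _ _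
  have h1 : ((⟨a, ha⟩ : A) • x : ℝ) = a * x := rfl
  rw [h1] at h
  simp only [φR, h]
  rfl

/-- `φ` takes values in `A`. [folklore] -/
theorem φR_mem (x : ℝ) : S.φR x ∈ A := (S.φ x).2

/-- `φ` kills `A` (because `φ 1 = 0`). [folklore] -/
theorem φR_of_mem {a : ℝ} (ha : a ∈ A) : S.φR a = 0 := by
  have := S.φR_mul_of_mem ha 1
  rw [mul_one] at this
  rw [this]
  simp [φR, S.φ_one]

/-- `φ 1 = 0`. [folklore] -/
theorem φR_one : S.φR 1 = 0 := S.φR_of_mem (one_mem A)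

/-- `φ u = 1`. [folklore] -/
theorem φR_u : S.φR S.u = 1 := by simp [φR, S.φ_u]

/-- `φ ℓ = c`. [folklore] -/
theorem φR_ℓ : S.φR S.ℓ = S.c := rfl

/-- `c = φ ℓ ≠ 0`. [folklore] -/
theorem c_ne_zero : S.c ≠ 0 := by
  intro h
  apply S.φ_ℓ
  have h' : ((S.φ S.ℓ : A) : ℝ) = 0 := h
  exact_mod_cast h'

/-- `c ∈ A`. [folklore] -/
theorem c_mem : S.c ∈ A := (S.φ S.ℓ).2

/-- `φ d = c − 1` (`d = ℓ − u`). [folklore] -/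
theorem φR_d : S.φR S.d = S.c - 1 := by
  rw [d, φR_sub, φR_ℓ, φR_u]

/-- `φ (φ(x) · t) = φ(x) · φ(t)`. [folklore] -/
theorem φR_φR_mul (x t : ℝ) : S.φR (S.φR x * t) = S.φR x * S.φR t :=
  S.φR_mul_of_mem (S.φR_mem x) t

/-- The complexified functional `Φ(x + iy) = φ x + i φ y`. [folklore] -/
def Φ (z : ℂ) : ℂ := (S.φR z.re : ℂ) + (S.φR z.im : ℂ) * I

/-- `Re Φ(z) = φ(Re z)`. [folklore] -/
@[simp] theorem Φ_re (z : ℂ) : (S.Φ z).re = S.φR z.re := by simp [Φ]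
/-- `Im Φ(z) = φ(Im z)`. [folklore] -/
@[simp] theorem Φ_im (z : ℂ) : (S.Φ z).im = S.φR z.im := by simp [Φ]

/-- The twist `θ z = z + Φ(z) d`. [folklore] -/
def θ (z : ℂ) : ℂ := z + S.Φ z * (S.d : ℂ)

/-- Its inverse `θ⁻¹ y = y - Φ(y) d / c`. [folklore] -/
def θinv (y : ℂ) : ℂ := y - S.Φ y * (S.d : ℂ) * ((S.c : ℂ))⁻¹

/-- `Re θ(z) = Re z + φ(Re z) d`. [folklore] -/
@[simp] theorem θ_re (z : ℂ) : (S.θ z).re = z.re + S.φR z.re * S.d := by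
  simp [θ]
/-- `Im θ(z) = Im z + φ(Im z) d`. [folklore] -/
@[simp] theorem θ_im (z : ℂ) : (S.θ z).im = z.im + S.φR z.im * S.d := by
  simp [θ]
/-- `Re θ⁻¹(y) = Re y − φ(Re y) d / c`. [folklore] -/
@[simp] theorem θinv_re (y : ℂ) : (S.θinv y).re = y.re - S.φR y.re * S.d * S.c⁻¹ := by
  simp [θinv, ← Complex.ofReal_inv]
/-- `Im θ⁻¹(y) = Im y − φ(Im y) d / c`. [folklore] -/
@[simp] theorem θinv_im (y : ℂ) : (S.θinv y).im = y.im - S.φR y.im * S.d * S.c⁻¹ := by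
  simp [θinv, ← Complex.ofReal_inv]

/-- `θ⁻¹ ∘ θ = id` (uses `φ(φ(x) t) = φ(x) φ(t)` and `φ d = c − 1`). [folklore] -/
theorem θinv_θ (z : ℂ) : S.θinv (S.θ z) = z := by
  have hc := S.c_ne_zero
  apply Complex.ext
  · rw [θinv_re, θ_re, φR_add, φR_φR_mul, φR_d]
    field_simp
    ring
  · rw [θinv_im, θ_im, φR_add, φR_φR_mul, φR_d]
    field_simp
    ring

/-- `θ ∘ θ⁻¹ = id`. [folklore] -/
theorem θ_θinv (y : ℂ) : S.θ (S.θinv y) = y := by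
  have hc := S.c_ne_zero
  have hcinv : S.c⁻¹ ∈ A := inv_mem S.c_mem
  apply Complex.ext
  · rw [θ_re, θinv_re, φR_sub]
    rw [show S.φR y.re * S.d * S.c⁻¹ = S.c⁻¹ * (S.φR y.re * S.d) by ring,
      S.φR_mul_of_mem hcinv, φR_φR_mul, φR_d]
    field_simp
    ring
  · rw [θ_im, θinv_im, φR_sub]
    rw [show S.φR y.im * S.d * S.c⁻¹ = S.c⁻¹ * (S.φR y.im * S.d) by ring,
      S.φR_mul_of_mem hcinv, φR_φR_mul, φR_d]
    field_simp
    ring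

/-- `θ` is a bijection of `ℂ`. [folklore] -/
theorem θ_bijective : Function.Bijective S.θ :=
  Function.bijective_iff_has_inverse.mpr ⟨S.θinv, S.θinv_θ, S.θ_θinv⟩

/-- `θ` is injective. [folklore] -/
theorem θ_injective : Function.Injective S.θ := S.θ_bijective.1

/-- `θ` is additive. [folklore] -/
theorem θ_add (z w : ℂ) : S.θ (z + w) = S.θ z + S.θ w := by
  apply Complex.ext <;> simp [φR_add] <;> ring

/-- `θ 0 = 0`. [folklore] -/
theorem θ_zero : S.θ 0 = 0 := by
  apply Complex.ext <;> simp [φR_zero]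

/-- `θ (−z) = −θ z`. [folklore] -/
theorem θ_neg (z : ℂ) : S.θ (-z) = -S.θ z := by
  apply Complex.ext <;> simp [φR_neg] <;> ring

/-- `θ 1 = 1` (because `φ 1 = 0`). [folklore] -/
theorem θ_one : S.θ 1 = 1 := by
  apply Complex.ext <;> simp [φR_zero, φR_one]

/-- `θ` commutes with complex conjugation. [folklore] -/
theorem θ_conj (z : ℂ) : S.θ ((starRingEnd ℂ) z) = (starRingEnd ℂ) (S.θ z) := by
  apply Complex.ext
  · rw [θ_re, Complex.conj_re, Complex.conj_re, θ_re]
  · rw [θ_im, Complex.conj_im, Complex.conj_im, θ_im, φR_neg]; ring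

/-- `θ` is `ℚ̄`-linear. [folklore] -/
theorem θ_mul_of_mem {q : ℂ} (hq : q ∈ Qb) (z : ℂ) : S.θ (q * z) = q * S.θ z := by
  have hre := re_mem_A hq
  have him := im_mem_A hq
  apply Complex.ext
  · simp only [θ_re, θ_im, Complex.mul_re]
    rw [φR_sub, S.φR_mul_of_mem hre, S.φR_mul_of_mem him]
    ring
  · simp only [θ_re, θ_im, Complex.mul_im]
    rw [φR_add, S.φR_mul_of_mem hre, S.φR_mul_of_mem him]
    ring

/-- `θ` fixes `ℚ̄` pointwise. [folklore] -/
theorem θ_of_mem {q : ℂ} (hq : q ∈ Qb) : S.θ q = q := by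
  simpa [θ_one] using S.θ_mul_of_mem hq 1

/-- `θ` is `ℚ`-linear. [folklore] -/
theorem θ_ratCast_mul (q : ℚ) (z : ℂ) : S.θ (q * z) = q * S.θ z :=
  S.θ_mul_of_mem (ratCast_mem_Qb q) z

/-- `θ` maps reals to reals: `θ x = x + φ(x) d`. [folklore] -/
theorem θ_ofReal (x : ℝ) : S.θ (x : ℂ) = ((x + S.φR x * S.d : ℝ) : ℂ) := by
  apply Complex.ext <;> simp [φR_zero]

/-- `θ` maps the imaginary axis to itself: `θ (ix) = i (x + φ(x) d)`. [folklore] -/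
theorem θ_ofReal_mul_I (x : ℝ) : S.θ ((x : ℂ) * I) = ((x + S.φR x * S.d : ℝ) : ℂ) * I := by
  apply Complex.ext <;> simp [φR_zero]

/-- The shear moves `u` to `ℓ`: `θ u = u + φ(u)(ℓ − u) = ℓ`. [folklore] -/
theorem θ_u : S.θ (S.u : ℂ) = (S.ℓ : ℂ) := by
  rw [θ_ofReal, φR_u, d]; push_cast; ring

/-- … and `iu` to `iℓ`. [folklore] -/
theorem θ_u_mul_I : S.θ ((S.u : ℂ) * I) = (S.ℓ : ℂ) * I := by
  rw [θ_ofReal_mul_I, φR_u, d]; push_cast; ring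

/-- `θ⁻¹` maps reals to reals. [folklore] -/
theorem θinv_ofReal (x : ℝ) : S.θinv (x : ℂ) = ((x - S.φR x * S.d * S.c⁻¹ : ℝ) : ℂ) := by
  apply Complex.ext <;> simp [φR_zero]

/-- `θ⁻¹` commutes with complex conjugation. [folklore] -/
theorem θinv_conj (z : ℂ) : S.θinv ((starRingEnd ℂ) z) = (starRingEnd ℂ) (S.θinv z) := by
  apply Complex.ext <;> simp [φR_neg]
  ring

/-- `θ⁻¹` is `ℚ̄`-linear. [folklore] -/
theorem θinv_mul_of_mem {q : ℂ} (hq : q ∈ Qb) (z : ℂ) : S.θinv (q * z) = q * S.θinv z := by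
  apply S.θ_injective
  rw [θ_θinv, θ_mul_of_mem _ hq, θ_θinv]

/-- `θ` as a `ℚ`-linear map. [folklore] -/
def θₗ : ℂ →ₗ[ℚ] ℂ where
  toFun := S.θ
  map_add' := S.θ_add
  map_smul' q z := by
    rw [Rat.smul_def, Rat.smul_def]
    exact S.θ_ratCast_mul q z

/-- `θ` as a `ℚ̄`-linear map. [folklore] -/
def θQb : ℂ →ₗ[Qb] ℂ where
  toFun := S.θ
  map_add' := S.θ_add
  map_smul' q z := by
    show S.θ ((q : ℂ) * z) = (q : ℂ) * S.θ z
    exact S.θ_mul_of_mem q.2 z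

/-- `θ` (injective, `ℚ`-linear) preserves `ℚ`-linear independence. [folklore] -/
theorem linearIndependent_θ {ι : Type*} {l : ι → ℂ} (hl : LinearIndependent ℚ l) :
    LinearIndependent ℚ (S.θ ∘ l) := by
  have hker : LinearMap.ker S.θₗ = ⊥ := LinearMap.ker_eq_bot.mpr S.θ_injective
  exact hl.map' S.θₗ hker

end Shear

end Summit.Schanuel.Schanuel.Theorems.RootDecomp1BTranscendencePackageFloor

end
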